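import Summits.HodgeConjecture.HodgeConjecture.Theorems.Ring2TransportWeilTypeGeneralCMFieldSU
import Summits.HodgeConjecture.HodgeConjecture.Theorems.IsotypicMiddleClassesAlgebraic.Negative.RationalFixed
import Literature.AlgebraicGeometry.HodgeTheory.WeilClassesFieldRationalSpan
import Mathlib.Algebra.Group.ForwardDiff
import Mathlib.LinearAlgebra.Eigenspace.Semisimple
import Mathlib.LinearAlgebra.Charpoly.ToMatrix
import Mathlib.FieldTheory.Minpoly.Field
import HarnessLib

/-!
# Ring-2 transport, gen 16: the descent node `WeilClassesFieldRationallySpanned` is a THEOREM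

HONEST FRAMING (page 1, verbatim for the cell). The transport axis is a RESEARCH ROUTE CONDITIONAL ON `HC_CM`
(`Theses.RankFourFaces.CMAbelianHodge`, an explicit binder, never a fact); NOT a corollary of anything in print; Question
11.4 SENTENCE 2 of Markman's survey is ALREADY REFUTED in dimension ≥ 3 (`SemiregularityWeakCriterionAbelianCounterexample`)
and is used nowhere below; [M] arXiv:2502.03415, [S] arXiv:2509.23403, [C] arXiv:2509.23079, [P] arXiv:2604.00511 are
UNREFEREED preprints and not inputs here. THIS FILE IS UNCONDITIONAL: `HC_CM` does not occur, no named fact is consumed, and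
the main theorem closes the axis' own obligation node `Ring2Transport.WeilClassesFieldRationallySpanned`
(`Theorems/Ring2TransportWeilTypeGeneralCMFieldSU.lean` §3, `[status: ours, expected theorem]`) in FULL generality — every
abelian variety `A`, endomorphism `φ`, `P ∈ ℤ[T]` (reducible or `0` allowed) and degree `r` — whereas the Literature theorem
`HodgeTheory.weilClassesField_le_span_isRationalClass` needs `P` irreducible with `P(φ) = 0`. Statement: `W := weilClassesField
A φ P r = ⨆_{P(ρ)=0} E_ρ`, `E_ρ := {c | T_{x,y} c = (x + yρ)ʳ c ∀ x y ∈ ℕ}`, `T_{x,y} := (x·𝟙 + y·φ)^*` on `Hʳ(A(ℂ); ℂ)`, lies in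
the complex span of its RATIONAL classes. No `Aut(ℂ/ℚ)`-descent and no exterior powers are used: only RATIONAL OPERATORS.

PROOF. The `T_{x,y}` commute pairwise and preserve rational classes; a joint kernel of rational-class-preserving operators is
spanned by rational classes (dual-functional trick `HodgeTheory.sum_smul_mem_span_dual`, run for a FAMILY). `r = 0`: each
`E_ρ = ⋂ ker (T_{x,y} - 1)`. `r = n + 1`: the forward-difference identity `Δ₁ⁿ[(t+ρ)^{n+1} - t^{n+1}](0) = (n+1)!·ρ` gives
RATIONAL `aₖ, b` with `Σₖ aₖ (k+ρ)^{n+1} + b = ρ` (all `ρ ∈ ℂ`), so the rational operator `L := Σ aₖ T_{k,1} + b` commutes with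
the `T_{x,y}` and acts on `E_ρ` as `ρ`. In a basis of rational classes `L` is a rational matrix, so a monic `χ ∈ ℚ[X]` kills
`L`; with `Z :=` the roots of `χ` that are roots of `P`, `μ := ∏_{ρ ∈ Z} minpoly_ℚ(ρ)` (distinct factors) is SEPARABLE,
vanishes on `Z`, and its complex roots are roots of `P`. With `Q_{x,y} := (x + yL)^r` put `J := ker μ(L) ∩ ⋂ ker (T_{x,y} -
Q_{x,y})`, a joint kernel of rational operators; CLAIM `W = J`. `⊆`: on `E_ρ` (`P(ρ)=0`) `L = ρ`, `Q_{x,y} = (x+yρ)^r =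
T_{x,y}`, and a non-zero `v ∈ E_ρ` is an `L`-eigenvector, so `χ(ρ) = 0`, `ρ ∈ Z`, `μ(L)v = μ(ρ)v = 0`. `⊇`: `L` preserves `J`,
`μ(L|_J) = 0` with `μ` squarefree, so `L|_J` is semisimple (`Module.End.isSemisimple_of_squarefree_aeval_eq_zero`) and `J` is
the sum of its `L`-eigenspaces (`IsSemisimple.iSup_eigenspace_eq_top`); on `J ∩ Eig(L,λ)`, `T_{x,y} = Q_{x,y} = (x+yλ)^r`, so
the piece lies in `E_λ`, and `λ` is a root of `μ` (if the piece is `≠ 0`), hence of `P`. (Separability is essential: for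
non-semisimple `φ^*`, `ker P(L) ⊋ W` can happen.)

References (bib keys): MoonenZarhin1998WeilClasses (§1: `W_F := ⋀^r_F H¹(X,ℚ)`, `W_F ⊗ ℂ = ⊕_σ ⋀^r V_{ℂ,σ}`),
Deligne1982HodgeCycles (§4 (4.4)), VoisinHodgeI2002 (§7.1.1), HatcherAT2002 (§3.1, Thm. 3.2, p. 198), vanGeemen1994HodgeAV
(4.8–4.9).
-/

set_option linter.dupNamespace false
noncomputable section
open CategoryTheory Polynomial

namespace Summit.HodgeConjecture.HodgeConjecture.Ring2Transport

open Literature.AlgebraicGeometry Literature.AlgebraicGeometry.Motives Literature.AlgebraicGeometry.HodgeTheory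
open Literature.AlgebraicTopology.SingularHomology
open Summit.HodgeConjecture.HodgeConjecture.Theorems.IsotypicMiddleClassesAlgebraic.Negative.RationalFixed (isRationalClass_sub)

/-- RATIONAL `a₀, …, aₙ, b` with `Σₖ aₖ (k + ρ)^{n+1} + b = ρ` for all complex `ρ`, from the forward-difference identity
`Δ₁ⁿ[(t+ρ)^{n+1}](0) - Δ₁ⁿ[t^{n+1}](0) = (n+1)!·ρ`: `aₖ = (-1)^{n-k} C(n,k)/(n+1)!`, `b = -Σₖ aₖ k^{n+1}`. [folklore] -/
theorem exists_rat_combination_translate_pow (n : ℕ) : ∃ (a : ℕ → ℚ) (b : ℚ), ∀ ρ : ℂ,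
    ∑ k ∈ Finset.range (n + 1), (a k : ℂ) * ((k : ℂ) + ρ) ^ (n + 1) + (b : ℂ) = ρ := by
  refine ⟨fun k ↦ ((-1 : ℚ) ^ (n - k) * (n.choose k : ℚ)) / ((n + 1).factorial : ℚ),
    -(∑ k ∈ Finset.range (n + 1), ((-1 : ℚ) ^ (n - k) * (n.choose k : ℚ)) * (k : ℚ) ^ (n + 1)) /
      ((n + 1).factorial : ℚ), fun ρ ↦ ?_⟩
  have hF : (fun t : ℂ ↦ (t + ρ) ^ (n + 1)) = ((fun t : ℂ ↦ t ^ (n + 1)) + (((n + 1 : ℕ) : ℂ) * ρ) • fun t : ℂ ↦ t ^ n) +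
      fun t : ℂ ↦ ∑ k ∈ Finset.range n, (((n + 1).choose k : ℂ) * ρ ^ (n + 1 - k)) * t ^ k := by
    funext t
    simp only [Pi.add_apply, Pi.smul_apply, smul_eq_mul]
    rw [add_pow, Finset.sum_range_succ, Finset.sum_range_succ]
    simp only [Nat.choose_self, Nat.choose_succ_self_right, Nat.sub_self, Nat.add_sub_cancel_left, pow_zero, pow_one,
      Nat.cast_one, mul_one]
    rw [Finset.sum_congr rfl fun k _ ↦ show t ^ k * ρ ^ (n + 1 - k) * ((n + 1).choose k : ℂ) =
      (((n + 1).choose k : ℂ) * ρ ^ (n + 1 - k)) * t ^ k by ring]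
    ring
  have key : (fwdDiff (1 : ℂ))^[n] (fun t : ℂ ↦ (t + ρ) ^ (n + 1)) 0 - (fwdDiff (1 : ℂ))^[n] (fun t : ℂ ↦ t ^ (n + 1)) 0 =
      ((n + 1).factorial : ℂ) * ρ := by
    rw [hF, fwdDiff_iter_add, fwdDiff_iter_add, fwdDiff_iter_const_smul, fwdDiff_iter_eq_factorial,
      fwdDiff_iter_sum_mul_pow_eq_zero]
    simp only [Pi.add_apply, Pi.smul_apply, Pi.zero_apply, Pi.natCast_apply, smul_eq_mul, add_zero, add_sub_cancel_left,
      Nat.factorial_succ, Nat.cast_mul]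
    ring
  rw [fwdDiff_iter_eq_sum_shift, fwdDiff_iter_eq_sum_shift] at key
  simp only [zero_add, nsmul_eq_mul, mul_one, zsmul_eq_mul, Int.cast_mul, Int.cast_pow, Int.cast_neg, Int.cast_one,
    Int.cast_natCast] at key
  push_cast
  simp only [div_mul_eq_mul_div, ← Finset.sum_div]
  rw [neg_div, ← sub_eq_add_neg, ← sub_div, key, mul_div_cancel_left₀ ρ (Nat.cast_ne_zero.2 (Nat.factorial_ne_zero _))]

section Toolkit

variable {Y : Type} [TopologicalSpace Y] {k : ℕ}

/-- Powers of a rational-class-preserving operator preserve rational classes. [cite: HatcherAT2002, §3.1] -/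
theorem isRationalClass_pow_apply (M : Module.End ℂ (singularCohomology ℂ ℂ Y k))
    (hM : ∀ c, IsRationalClass c → IsRationalClass (M c)) (j : ℕ) {c : singularCohomology ℂ ℂ Y k}
    (hc : IsRationalClass c) : IsRationalClass ((M ^ j) c) := by
  induction j generalizing c with
  | zero => rwa [pow_zero, Module.End.one_apply]
  | succ j ih => rw [pow_succ, Module.End.mul_apply]; exact ih (hM _ hc)

/-- A rational-class-preserving operator evaluated in a RATIONAL polynomial preserves rational classes. [cite: HatcherAT2002, §3.1] -/
theorem isRationalClass_aeval_apply (M : Module.End ℂ (singularCohomology ℂ ℂ Y k))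
    (hM : ∀ c, IsRationalClass c → IsRationalClass (M c)) (p : ℚ[X]) {c : singularCohomology ℂ ℂ Y k}
    (hc : IsRationalClass c) : IsRationalClass (aeval M (p.map (algebraMap ℚ ℂ)) c) := by
  rw [Polynomial.aeval_eq_sum_range, LinearMap.sum_apply, Finset.sum_congr rfl fun i _ ↦
    show ((p.map (algebraMap ℚ ℂ)).coeff i • M ^ i) c = ((p.coeff i : ℚ) : ℂ) • ((M ^ i) c) by
      rw [LinearMap.smul_apply, Polynomial.coeff_map, eq_ratCast]]
  exact IsRationalClass.sum_smul _ (fun j => isRationalClass_pow_apply M hM j hc) _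

/-- **Joint kernels of rational-class-preserving operators are spanned by rational classes** (FAMILY version of
`HodgeTheory.mem_span_isRationalClass_of_apply_eq_zero`: project by `ℚ`-linear functionals `ℂ → ℚ`). [cite: VoisinHodgeI2002, §7.1.1] -/
theorem mem_span_isRationalClass_of_forall_apply_eq_zero {ι : Type*} (F : ι → Module.End ℂ (singularCohomology ℂ ℂ Y k))
    (hF : ∀ i c, IsRationalClass c → IsRationalClass (F i c)) {c : singularCohomology ℂ ℂ Y k}
    (hc : c ∈ Submodule.span ℂ {x : singularCohomology ℂ ℂ Y k | IsRationalClass x}) (h0 : ∀ i, F i c = 0) :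
    c ∈ Submodule.span ℂ {x : singularCohomology ℂ ℂ Y k | IsRationalClass x ∧ ∀ i, F i x = 0} := by
  obtain ⟨m, g, b', rfl⟩ := Submodule.mem_span_set'.1 hc
  have hb : ∀ j, IsRationalClass (b' j : singularCohomology ℂ ℂ Y k) := fun j ↦ (b' j).2
  refine Submodule.span_mono ?_ (sum_smul_mem_span_dual g (fun j ↦ (b' j : singularCohomology ℂ ℂ Y k)))
  rintro _ ⟨ψ, rfl⟩
  exact ⟨IsRationalClass.sum_smul _ hb _, fun i ↦ apply_sum_dual_smul_eq_zero (F i) (hF i) hb (h0 i) ψ⟩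

variable (A : AbelianVariety ℂ) (k : ℕ)

/-- **Cayley–Hamilton over `ℚ`**: a rational-class-preserving operator on `Hᵏ(A(ℂ); ℂ)` is killed by a MONIC RATIONAL
polynomial (its matrix in a basis of rational classes is rational). [cite: VoisinHodgeI2002, §7.1.1] [cite: HatcherAT2002, §3.1] -/
theorem exists_monic_rat_aeval_eq_zero (L : Module.End ℂ (complexBetti A.X k))
    (hL : ∀ c, IsRationalClass c → IsRationalClass (L c)) : ∃ χ : ℚ[X], χ.Monic ∧ aeval L (χ.map (algebraMap ℚ ℂ)) = 0 := by
  classical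
  haveI := finite_complexBetti_abelianVariety A k
  obtain ⟨t, hts, htspan, hli⟩ := exists_linearIndependent ℂ {c : complexBetti A.X k | IsRationalClass c}
  have hspan : Submodule.span ℂ {c : complexBetti A.X k | IsRationalClass c} = ⊤ :=
    span_isRationalClass_eq_top_of_isSmoothProjective_holds _ _ (Motives.AbelianVariety.isSmoothProjective_holds (A := A)) k
  haveI : Fintype t := (hli.set_finite_of_isNoetherian).fintype
  let b : Module.Basis t ℂ (complexBetti A.X k) := Module.Basis.mk hli (by rw [Subtype.range_coe, htspan, hspan])
  have hb : ∀ i, IsRationalClass (b i) := fun i => by rw [Module.Basis.mk_apply]; exact hts i.2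
  have hent : ∀ i j, ∃ q : ℚ, (q : ℂ) = LinearMap.toMatrix b b L i j := fun i j => by
    obtain ⟨q, hq⟩ := repr_mem_range_ratCast_of_isRationalClass b hb (hL _ (hb j)) i
    exact ⟨q, by rw [LinearMap.toMatrix_apply]; exact hq⟩
  choose q hq using hent
  have hM : (Matrix.of fun i j => q i j).map (algebraMap ℚ ℂ) = LinearMap.toMatrix b b L := by
    ext i j; rw [Matrix.map_apply, Matrix.of_apply, eq_ratCast, hq]
  refine ⟨(Matrix.of fun i j => q i j).charpoly, Matrix.charpoly_monic _, ?_⟩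
  rw [← Matrix.charpoly_map, hM, LinearMap.charpoly_toMatrix]
  exact LinearMap.aeval_self_charpoly L

/-- A SEPARABLE `μ ∈ ℚ[X]` vanishing at every eigenvalue of `L` that is a root of `P ∈ ℤ[T]`, with all complex roots roots of
`P`: the product of the DISTINCT minimal polynomials over `ℚ` of those eigenvalues. [cite: MoonenZarhin1998WeilClasses, §1] -/
theorem exists_separable_rat_vanishing (L : Module.End ℂ (complexBetti A.X k))
    (hL : ∀ c, IsRationalClass c → IsRationalClass (L c)) (P : Polynomial ℤ) : ∃ μ : ℚ[X], μ.Separable ∧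
      (∀ ρ : ℂ, Polynomial.eval₂ (Int.castRingHom ℂ) ρ P = 0 → L.HasEigenvalue ρ → aeval ρ μ = 0) ∧
      (∀ ρ : ℂ, aeval ρ μ = 0 → Polynomial.eval₂ (Int.castRingHom ℂ) ρ P = 0) := by
  classical
  obtain ⟨χ, hχm, hχL⟩ := exists_monic_rat_aeval_eq_zero A k L hL
  have hχ0 : χ.map (algebraMap ℚ ℂ) ≠ 0 := (hχm.map _).ne_zero
  have hconv : ∀ ρ : ℂ, aeval ρ (P.map (Int.castRingHom ℚ)) = Polynomial.eval₂ (Int.castRingHom ℂ) ρ P := fun ρ ↦ by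
    rw [aeval_def, eval₂_map, RingHom.ext_int ((algebraMap ℚ ℂ).comp (Int.castRingHom ℚ)) (Int.castRingHom ℂ)]
  let Z : Finset ℂ := (χ.map (algebraMap ℚ ℂ)).roots.toFinset.filter (fun ρ => Polynomial.eval₂ (Int.castRingHom ℂ) ρ P = 0)
  have hZint : ∀ ρ ∈ Z, IsIntegral ℚ ρ := fun ρ hρ ↦ by
    have hr := Multiset.mem_toFinset.1 (Finset.mem_filter.1 hρ).1
    rw [mem_roots hχ0, IsRoot.def, eval_map_algebraMap] at hr
    exact ⟨χ, hχm, by rwa [← aeval_def]⟩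
  refine ⟨∏ q ∈ Z.image (minpoly ℚ), q, ?_, fun ρ hρP hρL ↦ ?_, fun ρ hρ ↦ ?_⟩
  · refine separable_prod' (fun q₁ hq₁ q₂ hq₂ hne ↦ ?_) (fun q hq ↦ ?_)
    · obtain ⟨ρ₁, hρ₁, rfl⟩ := Finset.mem_image.1 hq₁
      obtain ⟨ρ₂, hρ₂, rfl⟩ := Finset.mem_image.1 hq₂
      refine (minpoly.irreducible (hZint ρ₁ hρ₁)).coprime_iff_not_dvd.2 fun hdvd ↦ hne ?_
      exact eq_of_monic_of_associated (minpoly.monic (hZint ρ₁ hρ₁)) (minpoly.monic (hZint ρ₂ hρ₂))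
        ((minpoly.irreducible (hZint ρ₁ hρ₁)).associated_of_dvd (minpoly.irreducible (hZint ρ₂ hρ₂)) hdvd)
    · obtain ⟨ρ, hρ, rfl⟩ := Finset.mem_image.1 hq; exact (minpoly.irreducible (hZint ρ hρ)).separable
  · obtain ⟨v, hv⟩ := hρL.exists_hasEigenvector
    have hroot : (χ.map (algebraMap ℚ ℂ)).eval ρ = 0 := by
      have h := Module.End.aeval_apply_of_hasEigenvector (p := χ.map (algebraMap ℚ ℂ)) hv
      rw [hχL, LinearMap.zero_apply] at h
      exact (smul_eq_zero.1 h.symm).resolve_right hv.2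
    rw [map_prod]
    exact Finset.prod_eq_zero (Finset.mem_image_of_mem _
      (Finset.mem_filter.2 ⟨Multiset.mem_toFinset.2 ((mem_roots hχ0).2 hroot), hρP⟩)) (minpoly.aeval ℚ ρ)
  · obtain ⟨q, hq, hq0⟩ := Finset.prod_eq_zero_iff.1 (by rwa [map_prod] at hρ)
    obtain ⟨ρ₀, hρ₀, rfl⟩ := Finset.mem_image.1 hq
    rw [← hconv]
    exact aeval_eq_zero_of_dvd_aeval_eq_zero (minpoly.dvd ℚ ρ₀ (by rw [hconv]; exact (Finset.mem_filter.1 hρ₀).2)) hq0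

end Toolkit

section Operators

variable {A : AbelianVariety ℂ} {φ : A ⟶ A} {r : ℕ}

/-- The test operators commute pairwise: contravariance, and the endomorphisms `x·𝟙 + y·φ ∈ ℕ[φ]` commute. [folklore] -/
theorem testOp_comm (x y x' y' : ℕ) (c : complexBetti A.X r) :
    (complexBetti.map (x • 𝟙 A + y • φ).hom.hom.hom r).hom ((complexBetti.map (x' • 𝟙 A + y' • φ).hom.hom.hom r).hom c) =
      (complexBetti.map (x' • 𝟙 A + y' • φ).hom.hom.hom r).hom ((complexBetti.map (x • 𝟙 A + y • φ).hom.hom.hom r).hom c) := by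
  have hc : (x • 𝟙 A + y • φ) ≫ (x' • 𝟙 A + y' • φ) = (x' • 𝟙 A + y' • φ) ≫ (x • 𝟙 A + y • φ) := by
    simp only [Preadditive.add_comp, Preadditive.comp_add, Preadditive.nsmul_comp, Preadditive.comp_nsmul,
      Category.id_comp, Category.comp_id, smul_add, smul_smul, Nat.mul_comm x' x, Nat.mul_comm y' y, Nat.mul_comm x' y,
      Nat.mul_comm y' x]
    abel
  change singularCohomology.map ℂ ℂ (Motives.AlgPoints.mapContinuous (L := ℂ) (x • 𝟙 A + y • φ).hom.hom.hom) r
      (singularCohomology.map ℂ ℂ (Motives.AlgPoints.mapContinuous (L := ℂ) (x' • 𝟙 A + y' • φ).hom.hom.hom) r c) =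
    singularCohomology.map ℂ ℂ (Motives.AlgPoints.mapContinuous (L := ℂ) (x' • 𝟙 A + y' • φ).hom.hom.hom) r
      (singularCohomology.map ℂ ℂ (Motives.AlgPoints.mapContinuous (L := ℂ) (x • 𝟙 A + y • φ).hom.hom.hom) r c)
  rw [abelianVariety_map_map_apply, abelianVariety_map_map_apply, hc]

/-- Membership in `pullbackEigenclasses` via the test operators (definitional). [cite: vanGeemen1994HodgeAV, 4.8–4.9] -/
theorem mem_pullbackEigenclasses_iff_testOp {χ : ℕ → ℕ → ℂ} {c : complexBetti A.X r} :
    c ∈ pullbackEigenclasses A φ r χ ↔ ∀ x y : ℕ, (complexBetti.map (x • 𝟙 A + y • φ).hom.hom.hom r).hom c = χ x y • c :=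
  Iff.rfl

/-- The model operator `(x + yL)^r` acts on an `L`-eigenvector of eigenvalue `λ` by `(x + yλ)^r`. [folklore] -/
theorem model_apply_of_apply_eq_smul (L : Module.End ℂ (complexBetti A.X r)) {lam : ℂ} {v : complexBetti A.X r}
    (h : L v = lam • v) (x y : ℕ) :
    (((x : ℂ) • (1 : Module.End ℂ (complexBetti A.X r)) + (y : ℂ) • L) ^ r) v = ((x : ℂ) + (y : ℂ) * lam) ^ r • v := by
  have h1 : ((x : ℂ) • (1 : Module.End ℂ (complexBetti A.X r)) + (y : ℂ) • L) v = ((x : ℂ) + (y : ℂ) * lam) • v := by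
    rw [LinearMap.add_apply, LinearMap.smul_apply, LinearMap.smul_apply, Module.End.one_apply, h, smul_smul, ← add_smul]
  have hj : ∀ j : ℕ, (((x : ℂ) • (1 : Module.End ℂ (complexBetti A.X r)) + (y : ℂ) • L) ^ j) v =
      ((x : ℂ) + (y : ℂ) * lam) ^ j • v := fun j ↦ by
    induction j with
    | zero => rw [pow_zero, pow_zero, Module.End.one_apply, one_smul]
    | succ j ih => rw [pow_succ', Module.End.mul_apply, ih, map_smul, h1, smul_smul, pow_succ, mul_comm]
  exact hj r

/-- The model operators `(x + yL)^r` preserve rational classes when `L` does. [cite: HatcherAT2002, §3.1] -/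
theorem isRationalClass_model_apply (L : Module.End ℂ (complexBetti A.X r))
    (hL : ∀ c, IsRationalClass c → IsRationalClass (L c)) (x y : ℕ) {c : complexBetti A.X r} (hc : IsRationalClass c) :
    IsRationalClass ((((x : ℂ) • (1 : Module.End ℂ (complexBetti A.X r)) + (y : ℂ) • L) ^ r) c) := by
  refine isRationalClass_pow_apply _ (fun c hc ↦ ?_) r hc
  rw [LinearMap.add_apply, LinearMap.smul_apply, LinearMap.smul_apply, Module.End.one_apply]
  have e : ∀ (z : ℕ) (d : complexBetti A.X r), IsRationalClass d → IsRationalClass ((z : ℂ) • d) := fun z d hd ↦ by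
    simpa only [Rat.cast_natCast] using hd.smul (z : ℚ)
  exact (e x c hc).add (e y _ (hL c hc))

variable (A φ)

/-- **The affine operator** `L := Σₖ aₖ T_{k,1} + b·1` (degree `n + 1`): rational-class-preserving, commuting with every test
operator, and acting on each `E_ρ` as `ρ` (`T_{k,1} = (k + ρ)^{n+1}` on `E_ρ`). [cite: MoonenZarhin1998WeilClasses, §1] -/
theorem exists_affineOperator (n : ℕ) : ∃ L : Module.End ℂ (complexBetti A.X (n + 1)),
    (∀ c, IsRationalClass c → IsRationalClass (L c)) ∧
    (∀ (x y : ℕ) c, L ((complexBetti.map (x • 𝟙 A + y • φ).hom.hom.hom (n + 1)).hom c) =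
      (complexBetti.map (x • 𝟙 A + y • φ).hom.hom.hom (n + 1)).hom (L c)) ∧
    (∀ (ρ : ℂ) c, c ∈ pullbackEigenclasses A φ (n + 1) (fun x y => ((x : ℂ) + (y : ℂ) * ρ) ^ (n + 1)) → L c = ρ • c) := by
  obtain ⟨a, b, hab⟩ := exists_rat_combination_translate_pow n
  refine ⟨∑ k ∈ Finset.range (n + 1), ((a k : ℚ) : ℂ) • (complexBetti.map (k • 𝟙 A + (1 : ℕ) • φ).hom.hom.hom (n + 1)).hom +
    ((b : ℚ) : ℂ) • (1 : Module.End ℂ (complexBetti A.X (n + 1))), fun c hc ↦ ?_, fun x y c ↦ ?_, fun ρ c hc ↦ ?_⟩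
  · rw [LinearMap.add_apply, LinearMap.sum_apply, LinearMap.smul_apply, Module.End.one_apply]
    simp only [LinearMap.smul_apply]
    exact (IsRationalClass.sum_smul _ (fun j => isRationalClass_complexBetti_map _ hc) a).add (hc.smul b)
  · simp only [LinearMap.add_apply, LinearMap.sum_apply, LinearMap.smul_apply, Module.End.one_apply, map_add, map_sum, map_smul]
    congr 1
    exact Finset.sum_congr rfl fun j _ ↦ by rw [testOp_comm]
  · have hc' : ∀ j : ℕ, (complexBetti.map (j • 𝟙 A + (1 : ℕ) • φ).hom.hom.hom (n + 1)).hom c = (((j : ℕ) : ℂ) + ρ) ^ (n + 1) • c :=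
      fun j ↦ by simpa only [Nat.cast_one, one_mul] using (mem_pullbackEigenclasses_iff_testOp.1 hc) j 1
    simp only [LinearMap.add_apply, LinearMap.sum_apply, LinearMap.smul_apply, Module.End.one_apply, hc', smul_smul,
      ← Finset.sum_smul, ← add_smul, hab]

end Operators

section Main

variable {A : AbelianVariety ℂ} {φ : A ⟶ A} {r : ℕ}

/-- Evaluating a polynomial in a RESTRICTED operator is restricting the evaluation. [folklore] -/
theorem aeval_restrict_coe {V : Type*} [AddCommGroup V] [Module ℂ V] (L : Module.End ℂ V) {p : Submodule ℂ V}
    (hp : ∀ v ∈ p, L v ∈ p) (q : ℂ[X]) (v : p) : ((aeval (L.restrict hp) q) v : V) = aeval L q v := by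
  induction q using Polynomial.induction_on' with
  | add p₁ p₂ h₁ h₂ => rw [map_add, map_add, LinearMap.add_apply, LinearMap.add_apply, Submodule.coe_add, h₁, h₂]
  | monomial m a =>
    rw [aeval_monomial, aeval_monomial, Module.End.mul_apply, Module.End.mul_apply, Module.algebraMap_end_apply,
      Module.algebraMap_end_apply, Submodule.coe_smul, Module.End.pow_restrict m hp, LinearMap.coe_restrict_apply]

/-- **The sandwich `W = J := ker μ(L) ∩ ⋂ ker (T_{x,y} - (x+yL)^r)`** for a rational-class-preserving `L` commuting with the
test operators and acting on each `E_ρ` as `ρ` (module docstring). [cite: MoonenZarhin1998WeilClasses, §1] [cite: Deligne1982HodgeCycles, §4 (4.4)] -/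
theorem weilClassesField_le_span_of_affineOperator (L : Module.End ℂ (complexBetti A.X r))
    (hLrat : ∀ c, IsRationalClass c → IsRationalClass (L c)) (hLT : ∀ (x y : ℕ) c,
      L ((complexBetti.map (x • 𝟙 A + y • φ).hom.hom.hom r).hom c) = (complexBetti.map (x • 𝟙 A + y • φ).hom.hom.hom r).hom (L c))
    (hLE : ∀ (ρ : ℂ) c, c ∈ pullbackEigenclasses A φ r (fun x y => ((x : ℂ) + (y : ℂ) * ρ) ^ r) → L c = ρ • c)
    (P : Polynomial ℤ) :
    weilClassesField A φ P r ≤ Submodule.span ℂ {c | c ∈ weilClassesField A φ P r ∧ IsRationalClass c} := by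
  classical
  haveI := finite_complexBetti_abelianVariety A r
  obtain ⟨μ, hμsep, hμvan, hμroots⟩ := exists_separable_rat_vanishing A r L hLrat P
  set Q : ℕ → ℕ → Module.End ℂ (complexBetti A.X r) :=
    fun x y => ((x : ℂ) • (1 : Module.End ℂ (complexBetti A.X r)) + (y : ℂ) • L) ^ r with hQdef
  let F : Option (ℕ × ℕ) → Module.End ℂ (complexBetti A.X r) :=
    fun o => o.elim (aeval L (μ.map (algebraMap ℚ ℂ)))
      (fun p => (complexBetti.map (p.fst • 𝟙 A + p.snd • φ).hom.hom.hom r).hom - Q p.1 p.2)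
  have hFnone : F none = aeval L (μ.map (algebraMap ℚ ℂ)) := rfl
  have hFsome : ∀ x y : ℕ, F (some (x, y)) = (complexBetti.map (x • 𝟙 A + y • φ).hom.hom.hom r).hom - Q x y := fun _ _ ↦ rfl
  have hFrat : ∀ o c, IsRationalClass c → IsRationalClass (F o c) := by
    rintro (_ | ⟨x, y⟩) c hc
    · rw [hFnone]; exact isRationalClass_aeval_apply L hLrat μ hc
    · rw [hFsome, LinearMap.sub_apply]
      exact isRationalClass_sub (isRationalClass_complexBetti_map _ hc) (isRationalClass_model_apply L hLrat x y hc)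
  let K : Submodule ℂ (complexBetti A.X r) := ⨅ o, LinearMap.ker (F o)
  have hmemK : ∀ c, c ∈ K ↔ ∀ o, F o c = 0 := fun c ↦ by simp only [K, Submodule.mem_iInf, LinearMap.mem_ker]
  have hμL : ∀ (lam : ℂ) v, L v = lam • v → aeval L (μ.map (algebraMap ℚ ℂ)) v = (aeval lam μ) • v := by
    intro lam v hv
    by_cases hv0 : v = 0
    · rw [hv0, map_zero, smul_zero]
    · rw [Module.End.aeval_apply_of_hasEigenvector (f := L) (μ := lam) (x := v) ⟨Module.End.mem_eigenspace_iff.2 hv, hv0⟩,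
        eval_map_algebraMap]
  have hμLcomm : aeval L (μ.map (algebraMap ℚ ℂ)) * L = L * aeval L (μ.map (algebraMap ℚ ℂ)) := by
    have h := ((Commute.all (μ.map (algebraMap ℚ ℂ)) X).map (aeval L : ℂ[X] →ₐ[ℂ] Module.End ℂ (complexBetti A.X r))).eq
    rwa [aeval_X] at h
  have hQL : ∀ x y, Q x y * L = L * Q x y := fun x y ↦
    ((((Commute.one_left L).smul_left (x : ℂ)).add_left ((Commute.refl L).smul_left (y : ℂ))).pow_left r).eq
  have hWK : weilClassesField A φ P r ≤ K := by
    intro c hc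
    rw [mem_weilClassesField_iff] at hc
    refine (iSup₂_le (f := fun ρ (_ : ρ ∈ {ρ : ℂ | Polynomial.eval₂ (Int.castRingHom ℂ) ρ P = 0}) =>
      pullbackEigenclasses A φ r (fun x y => ((x : ℂ) + (y : ℂ) * ρ) ^ r)) fun ρ hρ c hcρ ↦ (hmemK c).2 ?_) hc
    rintro (_ | ⟨x, y⟩)
    · rw [hFnone, hμL ρ c (hLE ρ c hcρ)]
      by_cases hc0 : c = 0
      · rw [hc0, smul_zero]
      · rw [hμvan ρ hρ (Module.End.hasEigenvalue_of_hasEigenvector (f := L) (μ := ρ) (x := c)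
          ⟨Module.End.mem_eigenspace_iff.2 (hLE ρ c hcρ), hc0⟩), zero_smul]
    · rw [hFsome, LinearMap.sub_apply, (mem_pullbackEigenclasses_iff_testOp.1 hcρ) x y, hQdef,
        model_apply_of_apply_eq_smul L (hLE ρ c hcρ) x y, sub_self]
  have hKL : ∀ v ∈ K, L v ∈ K := fun v hv ↦ by
    rw [hmemK] at hv ⊢
    rintro (_ | ⟨x, y⟩)
    · have h := hv none
      rw [hFnone] at h ⊢
      rw [← Module.End.mul_apply, hμLcomm, Module.End.mul_apply, h, map_zero]
    · have h := hv (some (x, y))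
      rw [hFsome, LinearMap.sub_apply] at h ⊢
      have e : Q x y (L v) = L (Q x y v) := by rw [← Module.End.mul_apply, hQL, Module.End.mul_apply]
      rw [← hLT, e, ← map_sub, h, map_zero]
  have hKW : ∀ c ∈ K, c ∈ weilClassesField A φ P r := fun c hc ↦ by
    have h0 : aeval (L.restrict hKL) (μ.map (algebraMap ℚ ℂ)) = 0 := by
      ext v
      rw [LinearMap.zero_apply, Submodule.coe_zero, aeval_restrict_coe]
      have hv := ((hmemK _).1 v.2) none
      rwa [hFnone] at hv
    have hcK : (⟨c, hc⟩ : K) ∈ ⨆ lam : ℂ, Module.End.eigenspace (L.restrict hKL) lam := by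
      rw [(Module.End.isSemisimple_of_squarefree_aeval_eq_zero hμsep.map.squarefree h0).iSup_eigenspace_eq_top]
      exact Submodule.mem_top
    refine Submodule.iSup_induction _ (motive := fun u : K => (u : complexBetti A.X r) ∈ weilClassesField A φ P r) hcK
      (fun lam u hu ↦ ?_) (Submodule.zero_mem _) (fun u u' hu hu' ↦ Submodule.add_mem _ hu hu')
    have hLu : L (u : complexBetti A.X r) = lam • (u : complexBetti A.X r) := by
      rw [← LinearMap.coe_restrict_apply hKL u, Module.End.mem_eigenspace_iff.1 hu, Submodule.coe_smul]
    have huK := (hmemK _).1 u.2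
    by_cases hu0 : (u : complexBetti A.X r) = 0
    · rw [hu0]; exact Submodule.zero_mem _
    have hlam : Polynomial.eval₂ (Int.castRingHom ℂ) lam P = 0 := hμroots lam <| by
      have h := huK none; rw [hFnone, hμL lam _ hLu] at h; exact (smul_eq_zero.1 h).resolve_right hu0
    refine pullbackEigenclasses_le_weilClassesField hlam (mem_pullbackEigenclasses_iff_testOp.2 fun x y ↦ ?_)
    have h := huK (some (x, y))
    rw [hFsome, LinearMap.sub_apply, sub_eq_zero] at h
    rw [h, hQdef, model_apply_of_apply_eq_smul L hLu x y]
  intro c hc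
  have hsub : {x : complexBetti A.X r | IsRationalClass x ∧ ∀ o, F o x = 0} ⊆
      {c | c ∈ weilClassesField A φ P r ∧ IsRationalClass c} := fun x hx ↦ ⟨hKW x ((hmemK x).2 hx.2), hx.1⟩
  exact Submodule.span_mono hsub (mem_span_isRationalClass_of_forall_apply_eq_zero F hFrat
    (span_isRationalClass_eq_top_of_isSmoothProjective_holds.mem_span
      (Motives.AbelianVariety.isSmoothProjective_holds (A := A)) c) ((hmemK c).1 (hWK hc)))

/-- **Degree zero**: `E_ρ = ⋂ ker (T_{x,y} - 1)` for every `ρ`, a joint kernel of rational operators. [cite: MoonenZarhin1998WeilClasses, §1] -/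
theorem weilClassesField_zero_le_span (A : AbelianVariety ℂ) (φ : A ⟶ A) (P : Polynomial ℤ) :
    weilClassesField A φ P 0 ≤ Submodule.span ℂ {c | c ∈ weilClassesField A φ P 0 ∧ IsRationalClass c} := by
  let F : ℕ × ℕ → Module.End ℂ (complexBetti A.X 0) := fun p => (complexBetti.map (p.fst • 𝟙 A + p.snd • φ).hom.hom.hom 0).hom - 1
  have hFrat : ∀ p c, IsRationalClass c → IsRationalClass (F p c) := fun p c hc ↦ by
    rw [show F p c = (complexBetti.map (p.fst • 𝟙 A + p.snd • φ).hom.hom.hom 0).hom c - c from rfl]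
    exact isRationalClass_sub (isRationalClass_complexBetti_map _ hc) hc
  have hE : ∀ ρ c, c ∈ pullbackEigenclasses A φ 0 (fun x y => ((x : ℂ) + (y : ℂ) * ρ) ^ 0) ↔ ∀ p, F p c = 0 := fun ρ c ↦ by
    rw [mem_pullbackEigenclasses_iff_testOp]
    simp only [pow_zero, one_smul, F, LinearMap.sub_apply, Module.End.one_apply, sub_eq_zero, Prod.forall]
  intro c hc
  rw [mem_weilClassesField_iff] at hc
  refine (iSup₂_le (f := fun ρ (_ : ρ ∈ {ρ : ℂ | Polynomial.eval₂ (Int.castRingHom ℂ) ρ P = 0}) =>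
    pullbackEigenclasses A φ 0 (fun x y => ((x : ℂ) + (y : ℂ) * ρ) ^ 0)) fun ρ hρ c hcρ ↦ ?_) hc
  have hsub : {x : complexBetti A.X 0 | IsRationalClass x ∧ ∀ p, F p x = 0} ⊆
      {c | c ∈ weilClassesField A φ P 0 ∧ IsRationalClass c} :=
    fun x hx ↦ ⟨pullbackEigenclasses_le_weilClassesField hρ ((hE ρ x).2 hx.2), hx.1⟩
  exact Submodule.span_mono hsub (mem_span_isRationalClass_of_forall_apply_eq_zero F hFrat
    (span_isRationalClass_eq_top_of_isSmoothProjective_holds.mem_span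
      (Motives.AbelianVariety.isSmoothProjective_holds (A := A)) c) ((hE ρ c).1 hcρ))

/-- **MAIN THEOREM: the descent node `WeilClassesFieldRationallySpanned` (gen 5, `[status: ours, expected theorem]`) HOLDS**
— `weilClassesField A φ P r` is spanned by its rational classes for EVERY `(A, φ, P, r)` (no irreducibility of `P`, no
`P(φ) = 0`, no semisimplicity of `φ^*`); the binder `(hQ : WeilClassesFieldRationallySpanned)` of gen 5's rows is discharged
by name. [cite: MoonenZarhin1998WeilClasses, §1 (W_F ⊗ ℂ = ⊕_σ ⋀^r V_{ℂ,σ})] [cite: Deligne1982HodgeCycles, §4 (4.4)] -/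
theorem weilClassesFieldRationallySpanned_holds : WeilClassesFieldRationallySpanned := fun A φ P r ↦ by
  cases r with
  | zero => exact weilClassesField_zero_le_span A φ P
  | succ n =>
    obtain ⟨L, hLrat, hLT, hLE⟩ := exists_affineOperator A φ n
    exact weilClassesField_le_span_of_affineOperator L hLrat hLT hLE P

/-! ## Audit: `HC_CM` does not occur in this file and no named fact is a hypothesis here; axiom closure below = standard. -/
#print axioms Summit.HodgeConjecture.HodgeConjecture.Ring2Transport.weilClassesFieldRationallySpanned_holds

end Main

end Summit.HodgeConjecture.HodgeConjecture.Ring2Transport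

end
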